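import Mathlib

/-!
# Not so vicious cycles: cycles in permutations (Bóna 2011, Chapter 6)

Bóna, *A Walk Through Combinatorics* (3rd ed., 2011), Chapter 6 «Not So Vicious Cycles. Cycles in
Permutations»: §6.1 (products of permutations, cycles, cycle type, signless Stirling numbers of the
first kind), §6.2 (permutations with restricted cycle structure), Notes, and Exercises 1–25 with
their printed solutions; the Supplementary Exercises are out of scope.

**Currency.** An `n`-permutation is an `Equiv.Perm (Fin n)` (letters `0, …, n−1`); the book's
product `(f·g)(i) = g(f(i))` is Mathlib's `Equiv.trans f g = g * f`; the cycle type is Mathlib's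
multiset `Equiv.Perm.cycleType` of cycle lengths `≥ 2` (fixed points omitted); `c(n, k)` is
`Nat.stirlingFirst n k`; the permutation matrix `A_p` with `A_p(i, j) = 1 ⟺ p(i) = j` is
`Equiv.Perm.permMatrix`.

**What is typed here** (all proofs from Mathlib): Examples 6.2–6.3 (the running `312`, and
non-commutativity under the book's convention),
Example 6.10 (`(n−1)!` cycles of length `n`) and Theorem 6.9 at the type of a transposition
(`C(n, 2)`), and Exercises 1, 3, 11, 15, 16, 17, 18, 19 (the instance `n = 4, t = 3`), 20 and 22
(the transposition as the counterexample, via the sign).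

**Census — the chapter's other statements are already in the tree or in Mathlib and are cited, not
restated:** Lemma 6.4 / Corollary 6.6 (every entry returns within `n` steps; the cycles partition `[n]`) =
`CLNP.exists_pos_pow_apply_eq_self` (namespace `Literature.GroupTheory.CombinatorialGroupTheory`, file
`CommutatorLengthNPAssembly`)
and Mathlib's equivalence relation `Equiv.Perm.SameCycle`; Theorem 6.9 = `Equiv.Perm.card_of_cycleType` /
`card_of_cycleType_mul_eq`; Definition
6.11 as a count = `Literature.Combinatorics.Enumerative.card_perm_fin_filter_cycles_eq_stirlingFirst`
(file `StirlingFirstKindPermutationCycles`); Theorem 6.12 (6.2) = `Nat.stirlingFirst_succ_succ`;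
Lemma 6.13 (6.3) = `sum_perm_fin_pow_natCard_quotient_sameCycle_eq_prod` (same file) and
`BrentZimmermann2010.ConvergentStirlingCoefficients.sum_stirlingFirst_mul_pow`, with the row sum
`StirlingFirstKindEGF.sum_stirlingFirst_eq_factorial`; (6.4) =
`Literature.Combinatorics.Enumerative.sum_signedStirlingFirst_mul_pow_eq_prod`,
`StirlingFirstKindEGF.coeff_descPochhammer_eq` and `RStirlingOrthogonality.descPochhammer_eq_sum_signed_rStirlingFirst`;
Theorem 6.14 =
`RStirlingOrthogonality.sum_signed_stirlingFirst_mul_stirlingSecond`; Proposition 6.18 =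
`Literature.Combinatorics.Enumerative.two_mul_card_filter_sameCycle` and Lemma 6.19 =
`card_filter_card_support_cycleOf_eq` / `card_filter_apply_eq` (files
`StirlingFirstKindSignedAndMeanCycles`, `ExpectedNumberOfCycles`, typed from Bóna's other book);
Exercise 2 = `AssociatedStirlingFirstKindEGF.stirlingFirst_sub_two`; Exercise 5 =
`RestrictedBellNumbers.restrictedBell_two_succ_succ` with
`InvolutionsRestrictedBell.fintypeCard_involutions`; Exercise 7 =
`sum_perm_fin_natCard_quotient_sameCycle_eq_factorial_mul_harmonic` and
`HyperharmonicNumbers.factorial_mul_harmonic_eq_stirlingFirst`; Exercise 12 = `Matrix.permMatrix_mul`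
(with the order of factors reversed by the convention above); Exercise 14 =
`Equiv.Perm.cycleType_inv`; Exercise 15 (first half) = `Matrix.transpose_permMatrix`; Exercise 17
(minimality) = `Equiv.Perm.lcm_cycleType`; Exercise 20 in the currency of signs =
`Literature.Combinatorics.Enumerative.sum_sign_eq_zero`.  Not typed: Lemma 6.15 (the transition
lemma) with Exercise 9, Lemma 6.20 – Theorem 6.25 (`ODD`/`EVEN`, bijective), Exercises 4, 6, 8,
10, 13, 21, 23–25.

**Readings of the print said openly.** Solution 3 cites «(6.10)» for the `(n−1)!` count of
`n`-cycles, i.e. Example 6.10; Solution 4's degree «2n» is `2k` (for `c(n, n−k)`); Solutions 9–10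
print `Σ 1/n` for `Σ_{i=1}^{n} 1/i`; Exercise 1's «c(n, n 1)» is `c(n, n−1)`; in Solution 18
«n! 2t 1» is `n! − 2t − 1`.
-/
namespace Literature.Combinatorics.Enumerative.NotSoViciousCycles

open Equiv

/-- **Example 6.2** (p. 110), in Mathlib's `Equiv.Perm (Fin 3)` with `0`-indexed letters: the permutation
`f = 312` (`f(1) = 3, f(2) = 1, f(3) = 2`) is `(finRotate 3)⁻¹`; then `f² = 231 = finRotate 3` and `f³ = 123`
is the identity. [cite: Bona2011, Ch. 6 §6.1 Example 6.2, p. 110] -/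
theorem finRotate_three_inv_sq_and_cube :
    (finRotate 3)⁻¹ * (finRotate 3)⁻¹ = finRotate 3 ∧ ((finRotate 3)⁻¹) ^ 3 = (1 : Perm (Fin 3)) := by
  decide

/-- **Example 6.3** (p. 110): multiplication of permutations is not commutative.  With the book's
convention `(f · g)(i) = g(f(i))` — Mathlib's `Equiv.trans f g` (`= g * f`) — and `f = 312 = (finRotate 3)⁻¹`,
`g = 213 = swap 0 1`: `fg = 321` (the reversal `Fin.revPerm`) while `gf = 132 = swap 1 2`, and these differ.
[cite: Bona2011, Ch. 6 §6.1 Example 6.3, p. 110] -/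
theorem trans_finRotate_three_symm_swap_ne_comm :
    ((finRotate 3).symm.trans (Equiv.swap 0 1) : Perm (Fin 3)) = Fin.revPerm ∧
      ((Equiv.swap (0 : Fin 3) 1).trans (finRotate 3).symm : Perm (Fin 3)) = Equiv.swap 1 2 ∧
      ((finRotate 3).symm.trans (Equiv.swap 0 1) : Perm (Fin 3)) ≠
        (Equiv.swap (0 : Fin 3) 1).trans (finRotate 3).symm := by
  decide

/-- **Example 6.10** (p. 113): the number of `n`-permutations consisting of a single `n`-cycle is `(n−1)!`
(`n ≥ 2`; in Mathlib's currency, cycle type `{n}`; from Mathlib's `Equiv.Perm.card_of_cycleType_singleton`,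
the tree's `ExpectedNumberOfCycles.card_filter_cycleType_singleton_mul` being the general `k`-cycle count).
[cite: Bona2011, Ch. 6 §6.1 Example 6.10, p. 113] -/
theorem card_perm_cycleType_eq_singleton_self {n : ℕ} (hn : 2 ≤ n) :
    (Finset.univ.filter fun g : Perm (Fin n) => g.cycleType = {n}).card = Nat.factorial (n - 1) := by
  have h := Equiv.Perm.card_of_cycleType_singleton (α := Fin n) hn (by rw [Fintype.card_fin])
  rw [Fintype.card_fin, Nat.choose_self, mul_one] at h
  simpa using h

/-- **Theorem 6.9 at the cycle type `(n−2, 1, 0, …, 0)`** (p. 112): the number of `n`-permutations with one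
`2`-cycle and `n − 2` fixed points (the transpositions) is `n!/((n−2)!·1!·1^{n−2}·2^1) = C(n, 2)`; in Mathlib's
currency these are the permutations of cycle type `{2}`. [cite: Bona2011, Ch. 6 §6.1 Theorem 6.9, p. 112] -/
theorem card_perm_cycleType_eq_singleton_two {n : ℕ} (hn : 2 ≤ n) :
    (Finset.univ.filter fun g : Perm (Fin n) => g.cycleType = {2}).card = n.choose 2 := by
  have h := Equiv.Perm.card_of_cycleType_singleton (α := Fin n) (le_refl 2) (by rw [Fintype.card_fin]; exact hn)
  rw [Fintype.card_fin] at h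
  simpa using h

/-- **Exercise 1** (p. 120; solution p. 122): `c(n, n−1) = S(n, n−1) = C(n, 2)` — both count the choice of the
one doubleton (cycle, resp. block).  Stated at `n + 1`; the two values are Mathlib's
`Nat.stirlingFirst_succ_self_left` / `Nat.stirlingSecond_succ_self_left`.
[cite: Bona2011, Ch. 6 Exercise 1, pp. 120, 122] -/
theorem stirlingFirst_succ_self_eq_stirlingSecond (n : ℕ) :
    Nat.stirlingFirst (n + 1) n = Nat.stirlingSecond (n + 1) n ∧ Nat.stirlingFirst (n + 1) n = (n + 1).choose 2 := by
  rw [Nat.stirlingFirst_succ_self_left, Nat.stirlingSecond_succ_self_left]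
  exact ⟨rfl, rfl⟩

/-- **Exercise 3** (p. 120; solution p. 122): the row `n = 5` of the signless Stirling numbers of the first
kind, `c(5, 1) = 4! = 24`, `c(5, 2) = 50`, `c(5, 3) = 35`, `c(5, 4) = C(5, 2) = 10`, `c(5, 5) = 1`, summing to
`5! = 120` (the row sum is the tree's `StirlingFirstKindEGF.sum_stirlingFirst_eq_factorial`).
[cite: Bona2011, Ch. 6 Exercise 3, pp. 120, 122] -/
theorem stirlingFirst_five_row :
    Nat.stirlingFirst 5 1 = 24 ∧ Nat.stirlingFirst 5 2 = 50 ∧ Nat.stirlingFirst 5 3 = 35 ∧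
      Nat.stirlingFirst 5 4 = 10 ∧ Nat.stirlingFirst 5 5 = 1 ∧
      ∑ k ∈ Finset.range 6, Nat.stirlingFirst 5 k = Nat.factorial 5 := by
  decide

/-- **Exercise 11** (p. 121; solution p. 123): a permutation matrix has determinant `±1` (over `ℤ`; Mathlib's
`Matrix.det_permutation` gives `det A_p = sign p`). [cite: Bona2011, Ch. 6 Exercise 11, pp. 121, 123] -/
theorem natAbs_det_permMatrix {n : ℕ} (σ : Perm (Fin n)) : ((σ.permMatrix ℤ).det).natAbs = 1 := by
  rw [Matrix.det_permutation]
  rcases Int.units_eq_one_or (Equiv.Perm.sign σ) with h | h <;> simp [h]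

/-- **Exercise 15** (p. 121; solution p. 124): `A_p A_pᵀ = I` — the transpose of a permutation matrix is the
matrix of the inverse permutation (Mathlib's `Matrix.transpose_permMatrix`).
[cite: Bona2011, Ch. 6 Exercise 15, pp. 121, 124] -/
theorem permMatrix_mul_transpose_self {n : ℕ} {R : Type*} [Semiring R] (σ : Perm (Fin n)) :
    σ.permMatrix R * (σ.permMatrix R).transpose = 1 := by
  rw [Matrix.transpose_permMatrix, ← Matrix.permMatrix_mul, inv_mul_cancel, Matrix.permMatrix_one]

/-- **Exercise 16** (p. 121; solution p. 124): `pq` and `qp` have the same number of fixed points — by the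
book's route: the number of fixed points is the trace of the permutation matrix (Mathlib's
`Matrix.trace_permutation`), `A_{pq}` and `A_{qp}` are the two products of `A_p`, `A_q`
(`Matrix.permMatrix_mul`), and `trace (AB) = trace (BA)`. [cite: Bona2011, Ch. 6 Exercise 16, pp. 121, 124] -/
theorem ncard_fixedPoints_mul_comm {n : ℕ} (p q : Perm (Fin n)) :
    (Function.fixedPoints ⇑(p * q)).ncard = (Function.fixedPoints ⇑(q * p)).ncard := by
  have h1 := Matrix.trace_permutation (R := ℕ) (p * q)
  have h2 := Matrix.trace_permutation (R := ℕ) (q * p)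
  simp only [Nat.cast_id] at h1 h2
  rw [← h1, ← h2, Matrix.permMatrix_mul, Matrix.permMatrix_mul, Matrix.trace_mul_comm]

/-- **Exercise 17** (p. 121; solution p. 124): `p^d` is the identity for `d` the least common multiple of the
cycle lengths of `p` (and this `d` is the least such, Mathlib's `Equiv.Perm.lcm_cycleType : lcm = orderOf p`).
[cite: Bona2011, Ch. 6 Exercise 17, pp. 121, 124] -/
theorem pow_lcm_cycleType_eq_one {n : ℕ} (p : Perm (Fin n)) : p ^ p.cycleType.lcm = 1 := by
  rw [Equiv.Perm.lcm_cycleType]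
  exact pow_orderOf_eq_one p

/-- **Exercise 18, first step** (p. 121; solution p. 124): for `n ≥ 2` the number of `n`-permutations `p` with
`p² = identity` (the involutions together with the identity) is even — the book's pairing `p ↔ p⁻¹` of the
remaining permutations, here the inversion map as a permutation of `S_n` of square one, whose support has even
size (`Equiv.Perm.two_dvd_card_support`), with `n!` even. [cite: Bona2011, Ch. 6 Exercise 18, pp. 121, 124] -/
theorem even_card_perm_mul_self_eq_one {n : ℕ} (hn : 2 ≤ n) :
    Even (Finset.univ.filter fun p : Perm (Fin n) => p * p = 1).card := by
  set ι : Perm (Perm (Fin n)) := Equiv.inv (Perm (Fin n)) with hι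
  have hι2 : ι ^ 2 = 1 := by
    ext p : 1
    simp [ι, sq]
  have hdvd := Equiv.Perm.two_dvd_card_support hι2
  have hsupp : ι.supportᶜ = Finset.univ.filter fun p : Perm (Fin n) => p * p = 1 := by
    ext p
    simp [ι, Equiv.Perm.mem_support, inv_eq_iff_mul_eq_one]
  have hle : ι.support.card ≤ Nat.factorial n := by
    simpa [Fintype.card_perm, Fintype.card_fin] using Finset.card_le_univ ι.support
  have hcard : (Finset.univ.filter fun p : Perm (Fin n) => p * p = 1).card = Nat.factorial n - ι.support.card := by
    rw [← hsupp, Finset.card_compl, Fintype.card_perm, Fintype.card_fin]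
  have h2 : 2 ∣ Nat.factorial n := Nat.dvd_factorial (by norm_num) hn
  rcases hdvd with ⟨a, ha⟩
  rcases h2 with ⟨b, hb⟩
  exact ⟨b - a, by omega⟩

/-- **Exercise 18** (p. 121; solution p. 124): for `n > 1` the number of `n`-permutations whose square is the
identity, the identity itself excluded, is odd. [cite: Bona2011, Ch. 6 Exercise 18, pp. 121, 124] -/
theorem odd_card_perm_mul_self_eq_one_ne_one {n : ℕ} (hn : 2 ≤ n) :
    Odd (Finset.univ.filter fun p : Perm (Fin n) => p * p = 1 ∧ p ≠ 1).card := by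
  have h := even_card_perm_mul_self_eq_one hn
  have hmem : (1 : Perm (Fin n)) ∈ Finset.univ.filter fun p : Perm (Fin n) => p * p = 1 := by simp
  have hset : (Finset.univ.filter fun p : Perm (Fin n) => p * p = 1 ∧ p ≠ 1) =
      (Finset.univ.filter fun p : Perm (Fin n) => p * p = 1).erase 1 := by
    ext p
    simp only [Finset.mem_filter, Finset.mem_univ, true_and, Finset.mem_erase]
    tauto
  have hpos := Finset.card_pos.mpr ⟨1, hmem⟩
  rw [hset, Finset.card_erase_of_mem hmem]
  rcases h with ⟨r, hr⟩
  exact ⟨r - 1, by omega⟩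

/-- **Exercise 19, the instance `n = 4`, `t = 3`** (p. 121; solution p. 124): the `4`-permutations `p ≠ 1234`
with `p³ = 1234` are the eight `3`-cycles, and `8 ≡ −1 (mod 3)`. [cite: Bona2011, Ch. 6 Exercise 19, pp. 121, 124] -/
theorem card_perm_fin_four_cube_eq_one_ne_one :
    (Finset.univ.filter fun p : Perm (Fin 4) => p ^ 3 = 1 ∧ p ≠ 1).card = 8 ∧ (8 : ℤ) % 3 = (-1 : ℤ) % 3 := by
  refine ⟨by decide, by decide⟩

/-- **Exercise 20** (p. 121; solution p. 125): for `n ≥ 2` exactly half of the `n!` permutation matrices of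
size `n` have determinant `1` (over `ℤ`: `det A_p = sign p`, and the even permutations are half of `S_n`,
Mathlib's `two_mul_nat_card_alternatingGroup`; the tree's `StirlingFirstKindSignedAndMeanCycles.sum_sign_eq_zero`
is the same fact as `Σ_p sign p = 0`). [cite: Bona2011, Ch. 6 Exercise 20, pp. 121, 125] -/
theorem two_mul_card_perm_det_permMatrix_eq_one {n : ℕ} (hn : 2 ≤ n) :
    2 * (Finset.univ.filter fun σ : Perm (Fin n) => (σ.permMatrix ℤ).det = 1).card = Nat.factorial n := by
  haveI : Nontrivial (Fin n) := Fin.nontrivial_iff_two_le.mpr hn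
  have h := two_mul_nat_card_alternatingGroup (α := Fin n)
  have hA : Nat.card (alternatingGroup (Fin n)) =
      (Finset.univ.filter fun σ : Perm (Fin n) => (σ.permMatrix ℤ).det = 1).card := by
    rw [Nat.card_congr (Equiv.subtypeEquivRight (fun σ : Perm (Fin n) =>
      (show σ ∈ alternatingGroup (Fin n) ↔ (σ.permMatrix ℤ).det = 1 by
        rw [Equiv.Perm.mem_alternatingGroup, Matrix.det_permutation, Int.cast_id]
        exact Units.val_eq_one.symm))),
      Nat.card_eq_fintype_card, Fintype.card_subtype]
  rw [hA, Nat.card_eq_fintype_card, Fintype.card_perm, Fintype.card_fin] at h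
  exact h

/-- The square of any permutation is even (`sign (q·q) = (sign q)² = 1`); the engine of Exercise 22's
counterexample. [cite: Bona2011, Ch. 6 Exercise 22 (solution: «does not even have a square root»), p. 125] -/
theorem sign_mul_self_eq_one {n : ℕ} (q : Perm (Fin n)) : Equiv.Perm.sign (q * q) = 1 := by
  rw [Equiv.Perm.sign_mul]
  exact Int.units_mul_self _

/-- **Exercise 22, the counterexample** (p. 121; solution p. 125): a transposition `(i j)` has no square root
in `S_n` … [cite: Bona2011, Ch. 6 Exercise 22, pp. 121, 125] -/
theorem not_exists_mul_self_eq_swap {n : ℕ} {i j : Fin n} (hij : i ≠ j) :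
    ¬ ∃ q : Perm (Fin n), q * q = Equiv.swap i j := by
  rintro ⟨q, hq⟩
  have h := sign_mul_self_eq_one q
  rw [hq, Equiv.Perm.sign_swap hij] at h
  exact absurd h (by decide)

/-- **Exercise 22, continued**: … hence no fourth root either (a fourth root `q` would give the square root
`q²`), although the hypothesis of the would-be criterion at `k = 4` — an even number of cycles of each length
`4j` — holds for it vacuously (next theorem). [cite: Bona2011, Ch. 6 Exercise 22, pp. 121, 125] -/
theorem not_exists_pow_four_eq_swap {n : ℕ} {i j : Fin n} (hij : i ≠ j) :
    ¬ ∃ q : Perm (Fin n), q ^ 4 = Equiv.swap i j := by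
  rintro ⟨q, hq⟩
  refine not_exists_mul_self_eq_swap hij ⟨q ^ 2, ?_⟩
  rw [← pow_add]
  exact hq

/-- **Exercise 22, the vacuous hypothesis**: a transposition has cycle type `{2}` (Mathlib's
`Equiv.Perm.isSwap_iff_cycleType`), so it has zero — an even number of — cycles of every length `4j`.
[cite: Bona2011, Ch. 6 Exercise 22, pp. 121, 125] -/
theorem count_cycleType_swap_four_mul {n : ℕ} {i j : Fin n} (hij : i ≠ j) (m : ℕ) :
    Multiset.count (4 * m) (Equiv.swap i j).cycleType = 0 := by
  rw [Equiv.Perm.isSwap_iff_cycleType.mp ⟨i, j, hij, rfl⟩, Multiset.count_singleton]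
  split_ifs with h
  · omega
  · rfl

end Literature.Combinatorics.Enumerative.NotSoViciousCycles
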